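import Summits.CriticalPhenomena.PercolationContinuityZ3.Theorems.Transplant.GridCoverNets
import Summits.CriticalPhenomena.PercolationContinuityZ3.Theorems.Transplant.PlanarSkeletonFrmScaledDefs
import HarnessLib

/-!
# The hexagonal CROSSED-ROWS net `Cay(ℤ² ⋊_A ℤ; t, g)` (`A` of order 3; the `P6₂22` net of the lane's method-void row) carries NO planar unit-step skeleton
# — it contains a 7-cycle, and a unit-step chart makes a 4-regular graph bipartite (kernel method-void certificate, every chart)

builds on p205010 (kernel theorem, internal audit signed; external expert review pending) — nothing in this file uses p205010.
Lane `prim-bschramm`, seat `prim-bschramm-p4` (gen 19; PART C3, `HOME/bschramm/P4-GENERAL.md` §41).  Helper file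
(`--supports stmt-CriticalPhenomena-4575 --as helper`).

THE NET (P2-LATTICES §34 remark, O'Keeffe–Hyde §7.5.1): the Cayley graph of the crystallographic group `ℤ² ⋊_A ℤ`, `A` the rotation of order 3 of the
hexagonal lattice, on the translation letter `t = (u; 0)` and the screw letter `g = (0; 1)`: layer `k` consists of parallel ROWS in the direction `A^k u`
(three directions cycling with `k mod 3`), consecutive layers are joined by the rungs `(v,k) ∼ (v,k±1)`; 4-regular, girth 7, coordination sequence
`4, 12, 36, 72, 122, 188, …` (checked numerically in the seat).  Integer model on `ℤ³` (`TableNet`, 3 classes = `k mod 3`): rows along `(1,0)`, `(−1,1)`,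
`(0,1)` in layers `≡ 0, 1, 2`.  [`A` of order 6 gives the same graph; `A` of order 4 or a reflection gives `cds`, a Sign customer (`Cds.criticalContinuity`).]
THE CERTIFICATE.  `(0,0,0) ∼ (1,0,0) ∼ (1,0,1) ∼ (0,1,1) ∼ (0,1,2) ∼ (0,0,2) ∼ (0,0,1) ∼ (0,0,0)` is a closed walk of length 7 (row, rung, row, rung, row, rung, rung).
Under the field (ι) the coordinate sum `φ₀ + φ₁` changes by `±1` along every bond at a degree-4 vertex (p2's `coordSum_step_of_degree_le`), so seven such
changes cannot sum to zero (`false_of_heptagon`, file `GridCoverNets`): **`Xrows.isEmpty_planarSkeletonFrm / Neg / Sign / Conc / FrmFrom / FrmScaled`**.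
(The located reason of the lane's table — "three row directions, void for LINEAR charts" — thus holds for every chart: an odd ring.)
[cite: KozmaNitzan2024, §4 p. 15 (outward steps)] [cite: ConwaySloane1999, Ch. 4 §6.1]
-/

namespace Summit.CriticalPhenomena.PercolationContinuityZ3.Theorems.Transplant

open Literature.Probability.Percolation Literature.Probability.LatticeModels SimpleGraph GridCover

namespace Xrows

/-! ## §1 The crossed-rows graph on `ℤ³` -/

/-- The bond table: rungs `(0,0,±1)` and the row direction of the layer class. [cite: ConwaySloane1999, Ch. 4 §6.1] -/
def bonds : Fin 3 → Finset (Site 3) :=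
  ![{![0, 0, 1], ![0, 0, -1], ![1, 0, 0], ![-1, 0, 0]},
    {![0, 0, 1], ![0, 0, -1], ![-1, 1, 0], ![1, -1, 0]},
    {![0, 0, 1], ![0, 0, -1], ![0, 1, 0], ![0, -1, 0]}]

/-- No zero bond. [folklore] -/
theorem zero_notMem_bonds : ∀ c, (0 : Site 3) ∉ bonds c := by decide

/-- The bond table is symmetric. [folklore] -/
theorem neg_mem_bonds : ∀ c, ∀ v ∈ bonds c, -v ∈ bonds (TableNet.tgt 2 c v) := by decide

/-- Four bonds at every site. [folklore] -/
theorem card_bonds : ∀ c, (bonds c).card = 4 := by decide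

/-- **The crossed-rows graph.** [cite: ConwaySloane1999, Ch. 4 §6.1] -/
def graph : SimpleGraph (Site 3) := TableNet.graph 2 bonds

/-- The graph is locally finite. [folklore] -/
noncomputable instance graph_locallyFinite : graph.LocallyFinite := TableNet.graph_locallyFinite

/-- The crossed-rows net is 4-regular. [folklore] -/
theorem degree_eq (x : Site 3) : graph.degree x = 4 := TableNet.degree_eq zero_notMem_bonds neg_mem_bonds card_bonds x

/-- A table bond is an edge. [folklore] -/
theorem adj_of_mem {x y : Site 3} (h : y - x ∈ bonds (TableNet.cls 2 x)) : graph.Adj x y := TableNet.adj_of_mem zero_notMem_bonds h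

/-! ## §2 The heptagon and the certificate -/

/-- **The 7-cycle** row–rung–row–rung–row–rung–rung. [folklore] -/
noncomputable def heptagon : GridHeptagon graph where
  v₀ := ![0, 0, 0]
  v₁ := ![1, 0, 0]
  v₂ := ![1, 0, 1]
  v₃ := ![0, 1, 1]
  v₄ := ![0, 1, 2]
  v₅ := ![0, 0, 2]
  v₆ := ![0, 0, 1]
  h₀₁ := adj_of_mem (by decide)
  h₁₂ := adj_of_mem (by decide)
  h₂₃ := adj_of_mem (by decide)
  h₃₄ := adj_of_mem (by decide)
  h₄₅ := adj_of_mem (by decide)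
  h₅₆ := adj_of_mem (by decide)
  h₆₀ := adj_of_mem (by decide)
  d₀ := (degree_eq _).le
  d₁ := (degree_eq _).le
  d₂ := (degree_eq _).le
  d₃ := (degree_eq _).le
  d₄ := (degree_eq _).le
  d₅ := (degree_eq _).le
  d₆ := (degree_eq _).le

/-- **THEOREM (kernel no-go): the crossed-rows net carries no `PlanarSkeletonFrm`.** [cite: KozmaNitzan2024, §4 p. 15] -/
theorem isEmpty_planarSkeletonFrm : IsEmpty (PlanarSkeletonFrm graph) := ⟨fun Φ => heptagon.false_of_unitSteps Φ.step⟩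

/-- **… no `PlanarSkeletonNeg`.** [cite: KozmaNitzan2024, §4 p. 16 (Lemma 8)] -/
theorem isEmpty_planarSkeletonNeg : IsEmpty (PlanarSkeletonNeg graph) := ⟨fun Φ => heptagon.false_of_unitSteps Φ.step⟩

/-- **… no `PlanarSkeletonSign`.** [cite: KozmaNitzan2024, §4 p. 16 (Lemma 8)] -/
theorem isEmpty_planarSkeletonSign : IsEmpty (PlanarSkeletonSign graph) := ⟨fun Φ => heptagon.false_of_unitSteps Φ.step⟩

/-- **… no `PlanarSkeletonConc`.** [cite: KozmaNitzan2024, §4 p. 16 (Lemma 8)] -/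
theorem isEmpty_planarSkeletonConc : IsEmpty (PlanarSkeletonConc graph) := ⟨fun Φ => heptagon.false_of_unitSteps Φ.step⟩

/-- **… no `PlanarSkeletonFrmFrom`.** [cite: KozmaNitzan2024, §4 p. 15] -/
theorem isEmpty_planarSkeletonFrmFrom : IsEmpty (PlanarSkeletonFrmFrom graph) := ⟨fun Φ => heptagon.false_of_unitSteps Φ.step⟩

/-- **… and no `PlanarSkeletonFrmScaled`** (any step length). [cite: KozmaNitzan2024, §4 p. 15] -/
theorem isEmpty_planarSkeletonFrmScaled : IsEmpty (PlanarSkeletonFrmScaled graph) := ⟨fun Φ => heptagon.false_of_unitSteps Φ.steps_coarse⟩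

end Xrows

end Summit.CriticalPhenomena.PercolationContinuityZ3.Theorems.Transplant
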